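import Mathlib.Tactic.Group
import Literature.AnabelianGeometry.SemiGraphs.TemperedVerticial

/-!
# [SemiAnbd] Proposition 3.6 (iv), second clause: reduction to the verticial case

Mochizuki, *Semi-graphs of Anabelioids*, Publ. RIMS **42** (2006) 221–322, §3, Proposition 3.6
(iv) (manuscript p. 39) [cite: MochizukiSemiAnbd2006, Prop 3.6(iv) p.39]: "if the original morphism
of semi-graphs of anabelioids is locally open, then this morphism of temperoids
[`B^temp(𝒢') → B^temp(𝒢)`, i.e. `φ : π₁^temp(𝒢') → π₁^temp(𝒢)`] is relatively temp-slim" — typed as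
the second clause `F.IsLocallyOpen → IsRelativelyTempSlim φ` of the named fact
`InducedHomOfMorphism` (`TemperedVerticial.lean`).  The printed proof (p. 40) is one sentence: "the
remainder of assertion (iv) follows, in light of the injection of assertion (iii)
[`π₁^temp ↪ π̂₁`], formally from Corollary 2.7, (ii) [relative slimness on the profinite side]".
As recorded by abc-iut-L3-lead (rulings χ, β2; TREE-HEALTH RQ8), the formal transfer
(`RelativelyTempSlimTransfer.isRelativelyTempSlim_of_completion`) handles an open subgroup
`U ⊆ π₁^temp(𝒢')` of FINITE index (its closure in `π̂₁(𝒢')` is open), but print does not spell out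
the step for open subgroups of INFINITE index, which a tempered group has in abundance
(PRINT-TERSE, not a gap claim).

This proof-only file REDUCES the clause to ONE named residual fact which is itself the special
case of the clause for the locally open morphisms `𝒢_v ↪ 𝒢` (a single vertex):

* `VerticialHomRelativelyTempSlim 𝒢 c` — every vertex `v` carries a verticial homomorphism
  `ψ : Π_v → π₁^temp(𝒢)` (Prop. 3.2 / Thm. 3.7 (i)) which is relatively temp-slim: the centraliser
  in `π₁^temp(𝒢)` of the image of any OPEN subgroup of `Π_v` is trivial.  (On the profinite side
  this is Cor. 2.7 (ii) for `𝒢_v → 𝒢`; since `Π_v` is compact, the closure problem of ruling β2 does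
  not arise for it: images of open subgroups of `Π_v` are compact.)
* `InducedHomOfMorphism_clause2_of` — for `F : 𝒢' → 𝒢` locally open, charts `c'`, `c`, and any
  `φ : π₁^temp(𝒢') → π₁^temp(𝒢)` compatible with the verticial homomorphisms up to conjugation
  (the first clause of `InducedHomOfMorphism`), the residual facts for `(𝒢', c')` (only the
  existence of verticial homomorphisms is used) and for `(𝒢, c)` imply `IsRelativelyTempSlim φ`.
  PROOF (the infinite-index step made explicit): for `U ⊆ π₁^temp(𝒢')` open, pick a vertex `v'`
  (hypothesis `hasVertex` of Prop. 3.6) and a verticial `ψ' : Π_{v'} → π₁^temp(𝒢')`; the open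
  subgroup `W' := ψ'⁻¹(U)` of the COMPACT group `Π_{v'}` has finite index, so its image `W` under the
  locally open `Π_{v'} → Π_{F v'}` is open (`isOpen_map_of_isOpen_range`: closed of finite index in
  the open range); and `φ(U) ⊇ φ(ψ'(W')) = g·ψ(W)·g⁻¹`, whose centraliser is trivial by the residual
  fact at `F v'`.

No definitions besides the residual `Prop`; nothing here takes a side on any disputed step.
-/

namespace Literature.AnabelianGeometry.SemiGraphs

namespace ProfiniteSemiGraph

open Topology

universe u v

/-! ### A topological lemma: locally open homomorphisms of compact groups map open subgroups to
open subgroups -/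

/-- If `f : A → B` is a continuous homomorphism from a compact group whose range is open in the
Hausdorff group `B`, then `f` maps open subgroups to open subgroups: the image of an open (hence
finite-index, compact) subgroup is closed and of finite index in the open range.
[cite: MochizukiSemiAnbd2006, Def 2.2(ii) p.24] -/
theorem isOpen_map_of_isOpen_range {A : Type u} {B : Type v} [Group A] [TopologicalSpace A]
    [IsTopologicalGroup A] [CompactSpace A] [Group B] [TopologicalSpace B] [IsTopologicalGroup B]
    [T2Space B] (f : A →ₜ* B) (hf : IsOpen ((f.toMonoidHom.range : Subgroup B) : Set B))
    (W : Subgroup A) (hW : IsOpen (W : Set A)) :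
    IsOpen ((W.map f.toMonoidHom : Subgroup B) : Set B) := by
  classical
  -- the corestriction of `f` to its range `R`, a surjection
  set R : Subgroup B := f.toMonoidHom.range with hR
  let f' : A →* R := f.toMonoidHom.rangeRestrict
  have hf' : Function.Surjective f' := f.toMonoidHom.rangeRestrict_surjective
  have hf'c : Continuous f' := f.continuous.subtype_mk _
  let V : Subgroup R := W.map f'
  -- `W` has finite index (open in a compact group), hence so has its image `V`
  haveI : Finite (A ⧸ W) := Subgroup.quotient_finite_of_isOpen W hW
  haveI : W.FiniteIndex := Subgroup.finiteIndex_of_finite_quotient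
  haveI : V.FiniteIndex := by
    refine ⟨fun h0 => ?_⟩
    have hdvd := Subgroup.index_map_dvd (H := W) hf'
    rw [h0, zero_dvd_iff] at hdvd
    exact Subgroup.FiniteIndex.index_ne_zero hdvd
  -- `V` is closed: the image of the compact `W`
  have hVc : IsClosed (V : Set R) := by
    have hWc : IsCompact (W : Set A) := (Subgroup.isClosed_of_isOpen W hW).isCompact
    have himg : (V : Set R) = f' '' (W : Set A) := Subgroup.coe_map _ _
    rw [himg]
    exact (hWc.image hf'c).isClosed
  -- hence open in `R`, and `R` is open in `B`
  have hVo : IsOpen (V : Set R) := Subgroup.isOpen_of_isClosed_of_finiteIndex V hVc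
  have himage : ((W.map f.toMonoidHom : Subgroup B) : Set B) = Subtype.val '' (V : Set R) := by
    ext b
    simp only [Subgroup.coe_map, Set.mem_image, SetLike.mem_coe]
    constructor
    · rintro ⟨a, ha, rfl⟩
      exact ⟨f' a, ⟨a, ha, rfl⟩, rfl⟩
    · rintro ⟨r, ⟨a, ha, rfl⟩, rfl⟩
      exact ⟨a, ha, rfl⟩
  rw [himage]
  exact hf.isOpenMap_subtype_val _ hVo

/-! ### The residual named fact -/

variable (𝒢 : ProfiniteSemiGraph.{u}) in
/-- RESIDUAL NAMED FACT for [SemiAnbd] Prop. 3.6 (iv), second clause (print p. 40: "the remainder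
of assertion (iv) follows, in light of the injection of assertion (iii), formally from Corollary
2.7, (ii)" — terse for open subgroups of infinite index, rulings χ/β2): **the verticial
homomorphisms are relatively temp-slim** — every vertex `v` of `𝒢` carries a verticial
homomorphism `ψ : Π_v → π₁^temp(𝒢)` (Prop. 3.2, Thm. 3.7 (i)) such that for every open subgroup
`W ⊆ Π_v` the centraliser `Z_{π₁^temp(𝒢)}(ψ(W))` is trivial.  This is the second clause of
Prop. 3.6 (iv) for the locally open morphism `𝒢_v → 𝒢`; on the profinite side it is Cor. 2.7 (ii)
for that morphism, transported along `π₁^temp(𝒢) ↪ π̂₁(𝒢)` (no closure issue: `ψ(W)` is compact).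
As a BARE predicate on `(𝒢, c)` it is of course not a theorem (a one-vertex datum with
`Π_v = ℤ/2` and `π₁^temp = Π_v` refutes it); what print asserts — and what is to be proved
(abc-iut-L3-t10, `verticialHomRelativelyTempSlim_of`) — is `𝒢.Prop36Hypotheses → ∀ c, …`, where
verticial slimness and total elevation exclude such data (residual of record, L3-lead 21:55Z).
[cite: MochizukiSemiAnbd2006, Prop 3.6(iv) p.39] -/
def VerticialHomRelativelyTempSlim (c : TemperedPiChart 𝒢) : Prop :=
  ∀ v : 𝒢.graph.Vertex, ∃ ψ : 𝒢.Gv v →ₜ* c.G, IsVerticialHom c v ψ ∧ IsRelativelyTempSlim ψ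

/-! ### The reduction -/

variable {𝒢' 𝒢 : ProfiniteSemiGraph.{u}}

/-- The vertex groups `Π_v` are Hausdorff (totally disconnected topological groups).
[cite: MochizukiSemiAnbd2006, Def 2.1 p.22] -/
theorem t2Space_Gv (v : 𝒢.graph.Vertex) : T2Space (𝒢.Gv v) := by
  haveI : T1Space (𝒢.Gv v) :=
    ⟨fun x => connectedComponent_eq_singleton x ▸ isClosed_connectedComponent⟩
  infer_instance

/-- **[SemiAnbd] Prop. 3.6 (iv), second clause, reduced to the verticial case**: for a locally
open morphism `F : 𝒢' → 𝒢` (with `𝒢'` satisfying the hypotheses of Prop. 3.6 — a vertex is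
needed), charts `c'`, `c` and any continuous `φ : π₁^temp(𝒢') → π₁^temp(𝒢)` compatible with the
verticial homomorphisms up to conjugation (the first clause of `InducedHomOfMorphism`), if the
verticial homomorphisms of `𝒢'` exist and those of `𝒢` are relatively temp-slim
(`VerticialHomRelativelyTempSlim`), then `φ` is relatively temp-slim.
[cite: MochizukiSemiAnbd2006, Prop 3.6(iv) p.39] -/
theorem InducedHomOfMorphism_clause2_of (h𝒢' : 𝒢'.Prop36Hypotheses) (F : Hom 𝒢' 𝒢)
    (hF : F.IsLocallyOpen) (c' : TemperedPiChart 𝒢') (c : TemperedPiChart 𝒢) (φ : c'.G →ₜ* c.G)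
    (hφ : ∀ (v' : 𝒢'.graph.Vertex) (ψ' : 𝒢'.Gv v' →ₜ* c'.G)
      (ψ : 𝒢.Gv (F.base.vertexMap v') →ₜ* c.G),
      IsVerticialHom c' v' ψ' → IsVerticialHom c (F.base.vertexMap v') ψ →
        ∃ g : c.G, ∀ x, φ (ψ' x) = g * ψ (F.hV v' x) * g⁻¹)
    (h' : VerticialHomRelativelyTempSlim 𝒢' c') (h : VerticialHomRelativelyTempSlim 𝒢 c) :
    IsRelativelyTempSlim φ := by
  classical
  -- a vertex of `𝒢'`, verticial homomorphisms at it and at its image, and the conjugator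
  obtain ⟨v'⟩ := h𝒢'.hasVertex
  obtain ⟨ψ', hψ', -⟩ := h' v'
  obtain ⟨ψ, hψ, hslim⟩ := h (F.base.vertexMap v')
  obtain ⟨g, hg⟩ := hφ v' ψ' ψ hψ' hψ
  haveI := t2Space_Gv (𝒢 := 𝒢) (F.base.vertexMap v')
  refine ⟨fun U hU => ?_⟩
  -- `W' := ψ'⁻¹(U)`, open in the compact `Π_{v'}`; its image `W` in `Π_{F v'}` is open
  let W' : Subgroup (𝒢'.Gv v') := U.comap ψ'.toMonoidHom
  have hW' : IsOpen (W' : Set (𝒢'.Gv v')) := hU.preimage ψ'.continuous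
  let W : Subgroup (𝒢.Gv (F.base.vertexMap v')) := W'.map (F.hV v').toMonoidHom
  have hW : IsOpen (W : Set (𝒢.Gv (F.base.vertexMap v'))) :=
    isOpen_map_of_isOpen_range (F.hV v') (hF.1 v') W' hW'
  -- the centraliser of `ψ(W)` is trivial
  have hZ := hslim.centralizer_eq_bot W hW
  -- an element centralising `φ(U)` centralises `g ψ(W) g⁻¹ ⊆ φ(U)`
  rw [Subgroup.eq_bot_iff_forall] at hZ ⊢
  intro z hz
  rw [Subgroup.mem_centralizer_iff] at hz
  have hz' : g⁻¹ * z * g ∈ Subgroup.centralizer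
      ((W.map ψ.toMonoidHom : Subgroup c.G) : Set c.G) := by
    rw [Subgroup.mem_centralizer_iff]
    rintro _ ⟨_, ⟨x, hx, rfl⟩, rfl⟩
    -- `x ∈ W'`, i.e. `ψ' x ∈ U`, and `φ (ψ' x) = g * ψ (F.hV v' x) * g⁻¹`
    have hxU : φ (ψ' x) ∈ (U.map φ.toMonoidHom : Subgroup c.G) := ⟨ψ' x, hx, rfl⟩
    have hc := hz _ hxU
    rw [hg x] at hc
    -- `hc : g ψ(Fx) g⁻¹ * z = z * (g ψ(Fx) g⁻¹)`; conjugate by `g⁻¹`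
    change ψ (F.hV v' x) * (g⁻¹ * z * g) = g⁻¹ * z * g * ψ (F.hV v' x)
    have e1 : ψ (F.hV v' x) * (g⁻¹ * z * g) = g⁻¹ * (g * ψ (F.hV v' x) * g⁻¹ * z) * g := by
      group
    rw [e1, hc]
    group
  have h1 := hZ _ hz'
  -- `g⁻¹ z g = 1` forces `z = 1`
  have : z = g * (g⁻¹ * z * g) * g⁻¹ := by group
  rw [this, h1]
  group

end ProfiniteSemiGraph

end Literature.AnabelianGeometry.SemiGraphs
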